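/-
Copyright (c) 2026 the pub-hodgecm-mathlib formalisation cell (harness21).  Prover seat hodgecm-mathlib-LH7-p08 (g3) (Track A hand on the K2 L1 strike line),
hLiu418 = `stmt-HodgeConjecture-24832`; FACE-D₀ residue side, organ (O3b) «the closed-form unit κ♮» (K2E3-p23 (g9) 04:17:06Z (2), block-D desk K2Liu-p25 (g4)
WORD #12 (3), FACE-D₀ desk K2Liu-p02 (g10) WORDS #20–#21); 2026-09-05.
-/
import Summits.HodgeConjecture.HodgeConjecture.Theorems.K2LiuRankOneIndexClassDictionary        -- this seat ★ p865416 (O3): `smul_mul_dictNeg`, `reindex_smul_vecMulVec`, the `locF` dictionary, `hilbertSymbol_unit_mul_eq_neg_one_iff_locF_ne`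
import Summits.HodgeConjecture.HodgeConjecture.Theorems.K2LiuRankOneIndexValueTwoCorner          -- ★ (V-b) corner: `conj_single_apply_same`, `gramRL_apply_same_ne_zero`, `coe_gramR_apply_same`
import Summits.HodgeConjecture.HodgeConjecture.Theorems.K2LiuKindOneSingularCornerTraceLetter     -- ★ `trace_of_mem_maximalRealSubfield` (`Tr_{L∕L⁺} x = 2x` on `L⁺`)
import HarnessLib

/-!
# Crux `HLiu418`, FACE-D₀ residue side, organ (O3b): THE CORNER VALUE OF THE INDEX `dict′(b · c(u) ⊗ u)` — `σ · T₁₁ = −δ · b · N(s)`, the corner trace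
# `gramR₁₁ · Tr(σ·δ) = −2·δ²·b·N(s)` (so `val♮ = 2δ²·b·N(s)`: the closed-form unit is `κ♮ = 2δ²`), and `hvalClass` from the coherence letter `hcoh`

Cell `hodgecm-mathlib`, crux item hLiu418 = `stmt-HodgeConjecture-24832`; squad K2, strike line L1, LEAD F0P6-plan (g16); FACE-D₀ desk K2Liu-p02 (g10) (WORDS #20–#21: (O2)
runs at the ABSOLUTE value `val♮` of record with the dictionary letter `hvalClass` BY VALUE; (O3b) computes the unit and discharges `hvalClass` from ONE coherence letter
`hcoh`); second reader K2E3-p23 (g9) ((O2) ★-bound, `hcoh` producer census); block-D desk K2Liu-p25 (g4).  Pure algebra; THEOREMS ONLY (no `def`, no instance, no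
notation, no named-fact hypothesis, no `sorry`); lane `--supports stmt-HodgeConjecture-24832 --as helper` (count-neutral).

THE COMPUTATION (corner-free, `val₂`-free; frame = ★ `K2LiuRankOneIndexValueTwoCorner`'s literal `Fin 2`, corner at index `1`).  Let `X := dict′β = (−δ) • (T_L⁻¹ · β^{ρ⁻¹})`
with `β = b • c(u) ⊗ u` (`b ∈ L⁺`, `b ≠ 0`, `u ≠ 0`), and let `(g, D₀, σ)` be ANY corner transport of `X` in the sense of ★ p862643 (K1a-1) — Levi relation
`(c g)ᵀ · T_L · D₀ = T_L` and corner equation `D₀ · X · g⁻¹ = single 1 1 σ` (the hypotheses of ★ `corner_eq_val₂_mul_norm`; `σ = σc X` of the witnesses ★ p864217 (a)).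
Then `T_L · X = (c g)ᵀ · (T_L · single 1 1 σ) · g` and `T_L · X = (−δ) • β^{ρ⁻¹}` (★ (O3) `smul_mul_dictNeg`), whose `(k,k)` entries give `−δ·b·N(u(ρ k)) = N(g 1 k)·T₁₁·σ`;
at a `k` with `u(ρ k) ≠ 0`:
* **`corner_mul_gramR_eq_of_dictNeg_lineGram`**: `∃ s ≠ 0, σ · T₁₁ = −(δ·b) · N(s)` (`s = u(ρ k)·(g 1 k)⁻¹`, `N(s) = c s · s`, `T₁₁ = ι(gramR 1 1)`).
* **`cornerTrace_eq_of_corner_mul_gramR_eq`**: from `σ · T₁₁ = −(δ·b) · N(s)` with `b ∈ L⁺`: `gramR 1 1 · Tr_{L∕L⁺}(σ·δ) = −2 · δ² · b · N(s)` in `L⁺` (`σ·δ ∈ L⁺`,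
  `Tr = 2·` there, the `gramR 1 1` CANCELS) — i.e. the value of record `val♮ := −τ(σc X) = −gramR 1 1·Tr(σc X·δ)` (ruling #19; = the closed form `val°` at the pinned
  `α`, ★ `K2LiuIncoherentRankOneIndexValueOfRecord`) is **`val♮(dict′(b•c(u)⊗u)) = 2·δ²·b·N(s)`: closed-form unit `κ♮ = 2·δ² = 2·imagUnitSq L`** (`≡ −2` mod norms).
* **`hilbertSymbol_cornerValue_eq`**: hence `(ι_w(−gramR 1 1·Tr(σ·δ)), θ)_w = (ι_w(2δ²·b), θ)_w` (★ (O3) norm invariance).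
* **`hvalClass_of_hcoh`**: with the coherence letter `hcoh : (ι_w(2δ²·a′), θ)_w = 1` at the place `w` (producer: FACE-L's discriminant clause, K2E3-p23's census;
  an honest CONDITION «`−2a′` is a local norm at `w`», flagged on the bus 04:22:28Z), `(ι_w(val♮), θ)_w = −1 ↔ locF b w ≠ locF a′ w` — the `hvalClass` letter of
  desk WORD #20 at the absolute `val♮`, for every corner transport (★ (O3) `hilbertSymbol_unit_mul_eq_neg_one_iff_locF_ne`).
References: [KudlaRallis1994, §2–§3], [MoeglinWaldspurger1995, II.1.7], [Scharlau1985HermitianForms, Ch. 10 §1], [Shimura1997, §18.1 (18.4)], [Omeara1963, §63B],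
[Liu2021, Def. 4.11–4.12].

HONEST LABEL.  Count-neutral helper; the coherence letter `hcoh` is NOT proved here (it is a condition on the datum, see the bus flag); `hfac` stays OPEN until (O2)
lands; `HC_CM` is proved only modulo the 7 printed citations (2 remaining named inputs: hLiu418 = `stmt-HodgeConjecture-24832`, h413 = `stmt-HodgeConjecture-24833`)
until rung 0 closes.
-/

set_option autoImplicit false
set_option linter.dupNamespace false -- the mandated namespace repeats `HodgeConjecture.HodgeConjecture`

noncomputable section

open scoped Matrix
open NumberField IsDedekindDomain
open Literature.NumberTheory.QuadraticForms
open Literature.NumberTheory.Automorphic Literature.NumberTheory.Automorphic.UnitaryGroup Literature.NumberTheory.GaloisRepresentations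
open Literature.NumberTheory.Automorphic.Liu2021.Def411WeilCarriers
open Literature.NumberTheory.GelbartRogawski1991 Literature.NumberTheory.GelbartRogawski1991.GRConstruction
open Literature.NumberTheory.GelbartRogawski1991.UnitaryDualPair
open Summit.HodgeConjecture.HodgeConjecture.Cruxes.HLiu418.K2LiuSiegelUnipotentFourierDefs
open Summit.HodgeConjecture.HodgeConjecture.Cruxes.HLiu418.K2LiuHermitianSkewDictionary (isUnit_det_gramRL)
open Summit.HodgeConjecture.HodgeConjecture.Cruxes.HLiu418.K2LiuRankOneIndexValueTwoCorner (conj_single_apply_same gramRL_apply_same_ne_zero coe_gramR_apply_same gramR_apply_same_ne_zero)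
open Summit.HodgeConjecture.HodgeConjecture.Cruxes.HLiu418.K2LiuKindOneSingularCornerTraceLetter (trace_of_mem_maximalRealSubfield)
open Summit.HodgeConjecture.HodgeConjecture.Cruxes.HLiu418.K2LiuIncoherentRankOneIndexValueOfRecord (complexConj_mul_self_mem)
open Summit.HodgeConjecture.HodgeConjecture.Cruxes.HLiu418.K2LiuRankOneIndexClassDictionary

namespace Summit.HodgeConjecture.HodgeConjecture.Cruxes.HLiu418.K2LiuRankOneCornerValueAtLineGram

variable (L : Type) [Field L] [NumberField L] [IsCMField L]
variable {N M : ℕ} (e : Fin N × Fin M ≃ Fin 2)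
  (dV : Fin N → L) (hdV : ∀ i, IsCMField.complexConj L (dV i) = dV i) (hdV0 : ∀ i, dV i ≠ 0)
  (dW : Fin M → L) (hdW : ∀ i, IsCMField.complexConj L (dW i) = dW i) (hdW0 : ∀ i, dW i ≠ 0)

/-! ## §1 The corner parameter of `dict′(b • c(u) ⊗ u)` -/

include hdV0 hdW0 in
/-- **THE CORNER OF `dict′(b • c(u) ⊗ u)`**: for ANY corner transport `(g, D₀, σ)` of `X = dict′(b • c(u) ⊗ u)` (Levi relation + corner equation of ★ p862643),
`σ · T₁₁ = −(δ·b) · (c s · s)` for some `s ≠ 0` — read the `(k,k)` entry of `T_L·X = (c g)ᵀ·(T_L·single 1 1 σ)·g = (−δ·b)•c(u∘ρ) ⊗ (u∘ρ)` at a `k` with `u(ρ k) ≠ 0`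
(`s := u(ρ k)·(g 1 k)⁻¹`). [cite: KudlaRallis1994, §2–§3] [cite: MoeglinWaldspurger1995, II.1.7] [cite: Scharlau1985HermitianForms, Ch. 10 §1] -/
theorem corner_mul_gramR_eq_of_dictNeg_lineGram (ρ : Fin 2 ≃ Fin 2) {b : L} (hb : b ≠ 0) {u : Fin 2 → L} (hu : u ≠ 0) (g : GL (Fin 2) L)
    {D₀ : Matrix (Fin 2) (Fin 2) L}
    (hLevi : ((g : Matrix (Fin 2) (Fin 2) L).map ((IsCMField.complexConj L : L ≃ₐ[Fp L] L) : L →+* L))ᵀ * ((gramR L e dV hdV dW hdW).map (algebraMap (Fp L) L)) * D₀ = ((gramR L e dV hdV dW hdW).map (algebraMap (Fp L) L)))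
    {σ : L}
    (hcorner : D₀ * ((-imagUnit L) • (((gramR L e dV hdV dW hdW).map (algebraMap (Fp L) L))⁻¹ *
        Matrix.reindex ρ.symm ρ.symm (b • Matrix.vecMulVec (((IsCMField.complexConj L : L ≃ₐ[Fp L] L) : L →+* L) ∘ u) u))) *
        ((g : Matrix (Fin 2) (Fin 2) L))⁻¹ = Matrix.single 1 1 σ) :
    ∃ s : L, s ≠ 0 ∧ σ * ((gramR L e dV hdV dW hdW).map (algebraMap (Fp L) L)) 1 1 = -(imagUnit L * b) * (IsCMField.complexConj L s * s) := by
  -- the corner equation without the inverse: `D₀ X = single 1 1 σ · g`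
  have hginv : ((g : Matrix (Fin 2) (Fin 2) L))⁻¹ * (g : Matrix (Fin 2) (Fin 2) L) = 1 :=
    Matrix.nonsing_inv_mul _ ((Matrix.isUnit_iff_isUnit_det _).1 (Units.isUnit g))
  have hDX : D₀ * ((-imagUnit L) • (((gramR L e dV hdV dW hdW).map (algebraMap (Fp L) L))⁻¹ *
        Matrix.reindex ρ.symm ρ.symm (b • Matrix.vecMulVec (((IsCMField.complexConj L : L ≃ₐ[Fp L] L) : L →+* L) ∘ u) u))) =
      Matrix.single 1 1 σ * (g : Matrix (Fin 2) (Fin 2) L) := by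
    have := congrArg (fun A => A * (g : Matrix (Fin 2) (Fin 2) L)) hcorner
    simpa only [Matrix.mul_assoc, hginv, Matrix.mul_one] using this
  -- `T X = (c g)ᵀ (T single 1 1 σ) g`
  have hTX : ((gramR L e dV hdV dW hdW).map (algebraMap (Fp L) L)) * ((-imagUnit L) • (((gramR L e dV hdV dW hdW).map (algebraMap (Fp L) L))⁻¹ *
        Matrix.reindex ρ.symm ρ.symm (b • Matrix.vecMulVec (((IsCMField.complexConj L : L ≃ₐ[Fp L] L) : L →+* L) ∘ u) u))) =
      ((g : Matrix (Fin 2) (Fin 2) L).map ((IsCMField.complexConj L : L ≃ₐ[Fp L] L) : L →+* L))ᵀ * (((gramR L e dV hdV dW hdW).map (algebraMap (Fp L) L)) * Matrix.single 1 1 σ) * (g : Matrix (Fin 2) (Fin 2) L) := by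
    calc ((gramR L e dV hdV dW hdW).map (algebraMap (Fp L) L)) * ((-imagUnit L) • (((gramR L e dV hdV dW hdW).map (algebraMap (Fp L) L))⁻¹ *
            Matrix.reindex ρ.symm ρ.symm (b • Matrix.vecMulVec (((IsCMField.complexConj L : L ≃ₐ[Fp L] L) : L →+* L) ∘ u) u)))
        = (((g : Matrix (Fin 2) (Fin 2) L).map ((IsCMField.complexConj L : L ≃ₐ[Fp L] L) : L →+* L))ᵀ * ((gramR L e dV hdV dW hdW).map (algebraMap (Fp L) L)) * D₀) *
            ((-imagUnit L) • (((gramR L e dV hdV dW hdW).map (algebraMap (Fp L) L))⁻¹ * Matrix.reindex ρ.symm ρ.symm (b • Matrix.vecMulVec (((IsCMField.complexConj L : L ≃ₐ[Fp L] L) : L →+* L) ∘ u) u))) := by rw [hLevi]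
      _ = ((g : Matrix (Fin 2) (Fin 2) L).map ((IsCMField.complexConj L : L ≃ₐ[Fp L] L) : L →+* L))ᵀ * ((gramR L e dV hdV dW hdW).map (algebraMap (Fp L) L)) * (D₀ *
            ((-imagUnit L) • (((gramR L e dV hdV dW hdW).map (algebraMap (Fp L) L))⁻¹ * Matrix.reindex ρ.symm ρ.symm (b • Matrix.vecMulVec (((IsCMField.complexConj L : L ≃ₐ[Fp L] L) : L →+* L) ∘ u) u)))) := by
          simp only [Matrix.mul_assoc]
      _ = _ := by rw [hDX]; simp only [Matrix.mul_assoc]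
  -- `T X = (−δ·b) • c(u∘ρ) ⊗ (u∘ρ)`
  have hTX' : ((gramR L e dV hdV dW hdW).map (algebraMap (Fp L) L)) * ((-imagUnit L) • (((gramR L e dV hdV dW hdW).map (algebraMap (Fp L) L))⁻¹ *
        Matrix.reindex ρ.symm ρ.symm (b • Matrix.vecMulVec (((IsCMField.complexConj L : L ≃ₐ[Fp L] L) : L →+* L) ∘ u) u))) =
      (-(1 * imagUnit L) * b) • Matrix.vecMulVec (((IsCMField.complexConj L : L ≃ₐ[Fp L] L) : L →+* L) ∘ (u ∘ ρ)) (u ∘ ρ) := by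
    have h := smul_mul_dictNeg L e dV hdV hdV0 dW hdW hdW0 ρ 1 (b • Matrix.vecMulVec (((IsCMField.complexConj L : L ≃ₐ[Fp L] L) : L →+* L) ∘ u) u)
    rw [one_smul, reindex_smul_vecMulVec, smul_smul] at h
    exact h
  -- a coordinate `k` with `u (ρ k) ≠ 0`
  obtain ⟨k', hk'⟩ : ∃ k', u k' ≠ 0 := by
    by_contra h
    exact hu (funext fun i => not_not.1 fun hi => h ⟨i, hi⟩)
  have huk : u (ρ (ρ.symm k')) ≠ 0 := by rwa [Equiv.apply_symm_apply]
  -- the `(k,k)` entries: `−δ b N(u(ρ k)) = c(g 1 k) T₁₁ σ g 1 k`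
  have h2 : (((gramR L e dV hdV dW hdW).map (algebraMap (Fp L) L)) * ((-imagUnit L) • (((gramR L e dV hdV dW hdW).map (algebraMap (Fp L) L))⁻¹ *
        Matrix.reindex ρ.symm ρ.symm (b • Matrix.vecMulVec (((IsCMField.complexConj L : L ≃ₐ[Fp L] L) : L →+* L) ∘ u) u)))) (ρ.symm k') (ρ.symm k') =
      IsCMField.complexConj L ((g : Matrix (Fin 2) (Fin 2) L) 1 (ρ.symm k')) * ((gramR L e dV hdV dW hdW).map (algebraMap (Fp L) L)) 1 1 * σ * (g : Matrix (Fin 2) (Fin 2) L) 1 (ρ.symm k') := by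
    rw [hTX]
    exact conj_single_apply_same L e dV hdV dW hdW σ _ (ρ.symm k')
  have h1 : (((gramR L e dV hdV dW hdW).map (algebraMap (Fp L) L)) * ((-imagUnit L) • (((gramR L e dV hdV dW hdW).map (algebraMap (Fp L) L))⁻¹ *
        Matrix.reindex ρ.symm ρ.symm (b • Matrix.vecMulVec (((IsCMField.complexConj L : L ≃ₐ[Fp L] L) : L →+* L) ∘ u) u)))) (ρ.symm k') (ρ.symm k') =
      -(1 * imagUnit L) * b * (IsCMField.complexConj L (u (ρ (ρ.symm k'))) * u (ρ (ρ.symm k'))) := by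
    rw [hTX', Matrix.smul_apply, Matrix.vecMulVec_apply, smul_eq_mul]
    simp only [Function.comp_apply, RingHom.coe_coe]
  have hE := h1.symm.trans h2
  rw [one_mul] at hE
  -- `g 1 k ≠ 0`
  have hN0 : IsCMField.complexConj L (u (ρ (ρ.symm k'))) * u (ρ (ρ.symm k')) ≠ 0 := mul_ne_zero ((map_ne_zero _).2 huk) huk
  have hgk : (g : Matrix (Fin 2) (Fin 2) L) 1 (ρ.symm k') ≠ 0 := by
    intro h0
    rw [h0, mul_zero] at hE
    exact mul_ne_zero (mul_ne_zero (neg_ne_zero.2 (imagUnit_ne_zero L)) hb) hN0 hE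
  have hcgk : IsCMField.complexConj L ((g : Matrix (Fin 2) (Fin 2) L) 1 (ρ.symm k')) ≠ 0 := (map_ne_zero _).2 hgk
  have hNg : IsCMField.complexConj L ((g : Matrix (Fin 2) (Fin 2) L) 1 (ρ.symm k')) * (g : Matrix (Fin 2) (Fin 2) L) 1 (ρ.symm k') ≠ 0 :=
    mul_ne_zero hcgk hgk
  refine ⟨u (ρ (ρ.symm k')) * ((g : Matrix (Fin 2) (Fin 2) L) 1 (ρ.symm k'))⁻¹, mul_ne_zero huk (inv_ne_zero hgk), ?_⟩
  rw [map_mul, map_inv₀,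
    show IsCMField.complexConj L (u (ρ (ρ.symm k'))) * (IsCMField.complexConj L ((g : Matrix (Fin 2) (Fin 2) L) 1 (ρ.symm k')))⁻¹ *
        (u (ρ (ρ.symm k')) * ((g : Matrix (Fin 2) (Fin 2) L) 1 (ρ.symm k'))⁻¹) =
      (IsCMField.complexConj L (u (ρ (ρ.symm k'))) * u (ρ (ρ.symm k'))) *
        (IsCMField.complexConj L ((g : Matrix (Fin 2) (Fin 2) L) 1 (ρ.symm k')) * (g : Matrix (Fin 2) (Fin 2) L) 1 (ρ.symm k'))⁻¹ by
      rw [mul_inv]; ring,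
    ← mul_assoc, eq_mul_inv_iff_mul_eq₀ hNg]
  linear_combination -hE

/-! ## §2 The corner trace: `gramR₁₁ · Tr(σ·δ) = −2·δ²·b·N(s)` — the closed-form unit `κ♮ = 2δ²` -/

include hdV0 hdW0 in
/-- **THE CORNER TRACE OF `dict′(b • c(u) ⊗ u)`**: if `σ · T₁₁ = −(δ·b) · N(s)` with `b ∈ L⁺` (§1), then `gramR 1 1 · Tr_{L∕L⁺}(σ·δ) = −2·δ²·b·N(s)` in `L⁺`
(`σ·δ = −δ²·b·N(s)·(gramR 1 1)⁻¹ ∈ L⁺`, `Tr = 2·` on `L⁺`, the `gramR 1 1` cancels): the value of record `val♮ = −gramR 1 1·Tr(σc X·δ)` of the index `dict′(b • c(u) ⊗ u)` is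
`2·δ²·b·N(s)` — closed-form unit **`κ♮ = 2·δ²`**. [cite: Shimura1997, §18.1 (18.4)] [cite: Kudla1997, §2] -/
theorem cornerTrace_eq_of_corner_mul_gramR_eq (b : ↥(maximalRealSubfield L)) {σ s : L}
    (hσ : σ * ((gramR L e dV hdV dW hdW).map (algebraMap (Fp L) L)) 1 1 = -(imagUnit L * (b : L)) * (IsCMField.complexConj L s * s)) :
    (gramR L e dV hdV dW hdW) 1 1 * Algebra.trace (Fp L) L (σ * imagUnit L) =
      -(2 * (imagUnitSq L * (b * ⟨IsCMField.complexConj L s * s, complexConj_mul_self_mem L s⟩))) := by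
  have hT1 : ((gramR L e dV hdV dW hdW).map (algebraMap (Fp L) L)) 1 1 = (((gramR L e dV hdV dW hdW) 1 1 : ↥(maximalRealSubfield L)) : L) := (coe_gramR_apply_same L e dV hdV dW hdW 1).symm
  have hg0 : ((gramR L e dV hdV dW hdW) 1 1 : ↥(maximalRealSubfield L)) ≠ 0 := gramR_apply_same_ne_zero L e dV hdV hdV0 dW hdW hdW0 1
  have hg0L : ((((gramR L e dV hdV dW hdW) 1 1 : ↥(maximalRealSubfield L)) : L)) ≠ 0 := by
    rw [ne_eq, ZeroMemClass.coe_eq_zero]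
    exact hg0
  -- `σ·δ` as an element of `L⁺`
  have hδ2 : ((imagUnitSq L : ↥(maximalRealSubfield L)) : L) = imagUnit L * imagUnit L := (imagUnit_mul_self L).symm
  have hσδ : σ * imagUnit L =
      ((-(imagUnitSq L * (b * ⟨IsCMField.complexConj L s * s, complexConj_mul_self_mem L s⟩)) * ((gramR L e dV hdV dW hdW) 1 1)⁻¹ : ↥(maximalRealSubfield L)) : L) := by
    have hσ' : σ = -(imagUnit L * (b : L)) * (IsCMField.complexConj L s * s) * ((((gramR L e dV hdV dW hdW) 1 1 : ↥(maximalRealSubfield L)) : L))⁻¹ := by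
      rw [← hσ, hT1, mul_inv_cancel_right₀ hg0L]
    rw [hσ']
    push_cast
    rw [hδ2]
    ring
  rw [hσδ, trace_of_mem_maximalRealSubfield L (SetLike.coe_mem _), Subtype.coe_eta, nsmul_eq_mul, Nat.cast_ofNat]
  field_simp

/-! ## §3 The class reading at the absolute value of record -/

include hdV0 hdW0 in
/-- **THE VALUE OF RECORD HAS THE SYMBOL OF `2δ²·b`**: `(ι_w(−gramR 1 1·Tr(σ·δ)), θ)_w = (ι_w(2δ²·b), θ)_w` (§2 + ★ (O3) `hilbertSymbol_eq_of_mul_norm_eq`: the norm `N(s)` does not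
move the symbol). [cite: Omeara1963, §63B] [cite: Kudla1997, §2] -/
theorem hilbertSymbol_cornerValue_eq (w : HeightOneSpectrum (𝓞 ↥(maximalRealSubfield L))) (b : ↥(maximalRealSubfield L)) {σ s : L} (hs : s ≠ 0)
    (hσ : σ * ((gramR L e dV hdV dW hdW).map (algebraMap (Fp L) L)) 1 1 = -(imagUnit L * (b : L)) * (IsCMField.complexConj L s * s)) :
    hilbertSymbol (w.adicCompletion ↥(maximalRealSubfield L)) (algebraMap ↥(maximalRealSubfield L) (w.adicCompletion ↥(maximalRealSubfield L)) (-((gramR L e dV hdV dW hdW) 1 1 * Algebra.trace (Fp L) L (σ * imagUnit L))))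
        (algebraMap ↥(maximalRealSubfield L) (w.adicCompletion ↥(maximalRealSubfield L)) (cmQuadraticGenerator L : ↥(maximalRealSubfield L))) =
      hilbertSymbol (w.adicCompletion ↥(maximalRealSubfield L)) (algebraMap ↥(maximalRealSubfield L) (w.adicCompletion ↥(maximalRealSubfield L)) (2 * imagUnitSq L * b))
        (algebraMap ↥(maximalRealSubfield L) (w.adicCompletion ↥(maximalRealSubfield L)) (cmQuadraticGenerator L : ↥(maximalRealSubfield L))) := by
  rw [cornerTrace_eq_of_corner_mul_gramR_eq L e dV hdV hdV0 dW hdW hdW0 b hσ, neg_neg]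
  refine hilbertSymbol_eq_of_mul_norm_eq L w hs one_ne_zero ?_
  push_cast
  rw [map_one]
  ring

include hdV0 hdW0 in
/-- **`hvalClass` AT THE ABSOLUTE VALUE OF RECORD, FROM THE COHERENCE LETTER** (desk K2Liu-p02 WORD #20): for any corner transport of `X = dict′(b • c(u) ⊗ u)` with corner
relation `σ · T₁₁ = −(δ·b) · N(s)` (§1) and the ONE letter `hcoh : (ι_w(2δ²·a′), θ)_w = +1` («`−2a′` is a local norm at `w`» — a CONDITION on the datum, produced upstream),
`(ι_w(val♮), θ)_w = −1 ↔ locF b w ≠ locF a′ w` where `val♮ = −gramR 1 1·Tr(σ·δ)` (ruling #19). (§3 + ★ (O3) `hilbertSymbol_unit_mul_eq_neg_one_iff_locF_ne`.)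
[cite: Liu2021, Def. 4.11–4.12] [cite: Omeara1963, §63B] [cite: KudlaRallis1994, §3] -/
theorem hvalClass_of_hcoh (w : HeightOneSpectrum (𝓞 ↥(maximalRealSubfield L))) (a' b : (↥(maximalRealSubfield L))ˣ) {σ s : L} (hs : s ≠ 0)
    (hσ : σ * ((gramR L e dV hdV dW hdW).map (algebraMap (Fp L) L)) 1 1 = -(imagUnit L * ((b : ↥(maximalRealSubfield L)) : L)) * (IsCMField.complexConj L s * s))
    (hcoh : hilbertSymbol (w.adicCompletion ↥(maximalRealSubfield L)) (algebraMap ↥(maximalRealSubfield L) (w.adicCompletion ↥(maximalRealSubfield L)) (2 * imagUnitSq L * (a' : ↥(maximalRealSubfield L))))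
        (algebraMap ↥(maximalRealSubfield L) (w.adicCompletion ↥(maximalRealSubfield L)) (cmQuadraticGenerator L : ↥(maximalRealSubfield L))) = 1) :
    hilbertSymbol (w.adicCompletion ↥(maximalRealSubfield L)) (algebraMap ↥(maximalRealSubfield L) (w.adicCompletion ↥(maximalRealSubfield L)) (-((gramR L e dV hdV dW hdW) 1 1 * Algebra.trace (Fp L) L (σ * imagUnit L))))
        (algebraMap ↥(maximalRealSubfield L) (w.adicCompletion ↥(maximalRealSubfield L)) (cmQuadraticGenerator L : ↥(maximalRealSubfield L))) = -1 ↔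
      locF ↥(maximalRealSubfield L) (imagUnitSq L) b w ≠ locF ↥(maximalRealSubfield L) (imagUnitSq L) a' w := by
  have hd0 : (imagUnitSq L : ↥(maximalRealSubfield L)) ≠ 0 := fun h0 => by
    have h := imagUnit_mul_self L
    rw [h0, map_zero, mul_self_eq_zero] at h
    exact imagUnit_ne_zero L h
  rw [hilbertSymbol_cornerValue_eq L e dV hdV hdV0 dW hdW hdW0 w (b : ↥(maximalRealSubfield L)) hs hσ]
  exact hilbertSymbol_unit_mul_eq_neg_one_iff_locF_ne L w (mul_ne_zero two_ne_zero hd0) a' b hcoh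

end Summit.HodgeConjecture.HodgeConjecture.Cruxes.HLiu418.K2LiuRankOneCornerValueAtLineGram

end
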